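import Summits.QuantumFields.BalabanUV.Beta.GAN24.BornLambdaSectorRowHolds
import Summits.QuantumFields.BalabanUV.Beta.GAN24.BornBorderUndressedRow
import Summits.QuantumFields.BalabanUV.Beta.GAN24.TaylorRowVSymAt
import Summits.QuantumFields.BalabanUV.Beta.GAN24.S3ShapeVtSymAt
import Summits.QuantumFields.BalabanUV.Beta.GAN24.S3RowV0SymAt
import Summits.QuantumFields.BalabanUV.Beta.GAN24.SrecAtRowOfSectors
import Summits.QuantumFields.BalabanUV.Beta.GAN24.WilsonSectorRowHolds

/-!
# GAN24 ∕ CT-ROUTE — `SrecAtBornRowHolds`: `hS0` OF THE `d = 3` COMB FAMILY FROM THE V BORN CONTACT LETTER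

NOT IN PRINT; OUR BOOKKEEPING ([folklore] assembly BY NAME; no estimate of Bałaban's is formalised, cited or discharged here).
HONEST: CONDITIONAL on exactly ONE letter — the per-lineage V contact letter `hCgV` ((C4)-V, leaf-03 g55); everything else (the Wilson row `hW`, the whole Λ half of hB —
leaf-04 g56's `BornLambdaSectorRowHolds.exists_hBLam_three` over leaf-02's (C4) `exists_hCg_three` and the owner's `BornLambdaRowHolds` —, the undressed V rows) is discharged
BY NAME.  hS0 of the comb family is NOT (hS, hSall), NOT (CONV-C); NEVER «G-an2-4 closed»; NOT D1, NOT `BetaPertH`, NOT continuum, NOT Clay.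

WHAT.  `exists_hBv_three_of_contact_poly`: `hB(cVH, 0)` ⇐ `hCgV` (the owner's `BornBorderUndressedRow.exists_hBv_of_rootedRows_poly` with gan24-p2's three symmetric-table rooted V
rows `TaylorRowVSymAt.rowV_three_at`, `S3ShapeVtSymAt.shapeVt_three_at`, `S3RowV0SymAt.shapeV0_at` BY NAME); `exists_hB_three_of_contact`: hB ⇐ `hCgV` (leaf-01's
`BornLambdaLineage.exists_hB_of_sectors` over leaf-04 g56's hypothesis-free Λ half `BornLambdaSectorRowHolds.exists_hBLam_three`); `exists_hS0_SrecAt_three_of_contact`: hS0 of the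
comb family ⇐ `hCgV` (`SrecAtRowOfSectors.exists_hS0_SrecAt_of_sectors` with the Wilson row `WilsonSectorRowHolds.exists_hS0_wilsonSec`).

Unit `b2b-balaban-gan24-p1` (row owner G-an2-4, gen 21), 2026-08-21.
-/

noncomputable section

open Finset
open scoped BigOperators
open Literature.MathematicalPhysics.QuantumFieldTheory
open Literature.MathematicalPhysics.QuantumFieldTheory.Balaban1983to89
open Literature.MathematicalPhysics.QuantumFieldTheory.Balaban1983to89.Beta
open OneStepResolventKernel (Fib LocStencil)
open AffineAveraging (box toSite)
open AveragingHessianKernelsRooted (vhSAt)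
open Summit.QuantumFields.BalabanUV.Beta.HessKerDressedUnits (unitS)
open Summit.QuantumFields.BalabanUV.Beta.GAN24.CombesThomas (sfStep smStep KStepUnit)
open BalabanCompositeJets (respStep)
open Summit.QuantumFields.BalabanUV.Beta.GAN24.Push3 (push₃)
open Summit.QuantumFields.BalabanUV.Beta.GAN24.SrecLinearPartEq (colM rowMM reslot)
open Summit.QuantumFields.BalabanUV.Beta.GAN24.SrecWilsonSector (bornSecAt)
open Summit.QuantumFields.BalabanUV.Beta.GAN24.SrecBornSector (unitStepMap)
open Summit.QuantumFields.BalabanUV.Beta.GAN24.AffineUnroll (transport)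
open Summit.QuantumFields.BalabanUV.Beta.WardLocusRecursive (SrecAt)
open Summit.QuantumFields.BalabanUV.Beta.GAN24.BornLambdaLineage (exists_hB_of_sectors)
open Summit.QuantumFields.BalabanUV.Beta.GAN24.BornLambdaSectorRowHolds (exists_hBLam_three)
open Summit.QuantumFields.BalabanUV.Beta.GAN24.BornBorderUndressedRow (exists_hBv_of_rootedRows_poly)
open Summit.QuantumFields.BalabanUV.Beta.GAN24.TaylorRowVSymAt (rowV_three_at)
open Summit.QuantumFields.BalabanUV.Beta.GAN24.S3ShapeVtSymAt (shapeVt_three_at)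
open Summit.QuantumFields.BalabanUV.Beta.GAN24.S3RowV0SymAt (shapeV0_at)
open Summit.QuantumFields.BalabanUV.Beta.GAN24.SrecAtRowOfSectors (exists_hS0_SrecAt_of_sectors)
open Summit.QuantumFields.BalabanUV.Beta.GAN24.WilsonSectorRowHolds (exists_hS0_wilsonSec)

namespace Summit.QuantumFields.BalabanUV.Beta.GAN24.SrecAtBornRowHolds

variable {Lc : ℕ} [NeZero Lc]

/-- NOT IN PRINT; OUR PROOF ATTEMPT — CONDITIONAL ON ONE LETTER ([folklore] assembly).  **`hB(cVH, 0)` OF THE `d = 3` COMB FAMILY FROM THE V CONTACT LETTER ALONE**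
(the three symmetric-table rooted V rows of gan24-p2 BY NAME into `exists_hBv_of_rootedRows_poly`). -/
theorem exists_hBv_three_of_contact_poly (hLc : 2 ≤ Lc) {cE : ℝ} (hcE : cE = (Lc : ℝ) ^ (3 + 1)) (cVH : ℝ) (p : ℕ)
    (hCgV : ∃ C θ δ : ℝ, 0 ≤ C ∧ 0 ≤ θ ∧ θ < 1 ∧ 0 < δ ∧ ∀ (rr : Fin (3 + 1) → ℕ), rr ∈ box (3 + 1) Lc → ∀ k i : ℕ, i < k →
      LocStencil (transport (unitStepMap Lc (toSite rr) cE) (i + 1) (k - 1 - i)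
          (unitStepMap Lc (toSite rr) cE i (fun κ u => cVH • vhSAt (toSite rr) 3 Lc rfl κ u))
        - fun κ' u' => (cE * (Lc : ℝ) ^ (2 * (3 + 1))) ^ (k - i) •
          push₃ (respStep (d := 3) (Lc ^ (i + 1)) (Lc ^ k)) (respStep (d := 3) (Lc ^ (i + 1)) (Lc ^ k)) (respStep (d := 3) (Lc ^ (i + 1)) (Lc ^ k))
            (fun κ u => -(push₃ (-respStep (d := 3) (Lc ^ i) (Lc ^ (i + 1))) (colM (KStepUnit (d := 3) Lc i) Lc)
                  (respStep (d := 3) (Lc ^ i) (Lc ^ (i + 1))) (reslot Sum.inl Sum.inr fun κ u => cVH • vhSAt (toSite rr) 3 Lc rfl κ u) κ u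
              + push₃ (rowMM (KStepUnit (d := 3) Lc i) Lc) (respStep (d := 3) (Lc ^ i) (Lc ^ (i + 1)))
                  (respStep (d := 3) (Lc ^ i) (Lc ^ (i + 1))) (reslot Sum.inr Sum.inl fun κ u => cVH • vhSAt (toSite rr) 3 Lc rfl κ u) κ u)) κ' u')
        (C * (((k - i : ℕ) : ℝ) ^ p * θ ^ (k - i))) δ) :
    ∃ C δ : ℝ, 0 < δ ∧ ∀ (rr : Fin (3 + 1) → ℕ), rr ∈ box (3 + 1) Lc →
      ∀ k : ℕ, LocStencil (unitS (sfStep Lc k) (smStep 3 Lc k) (bornSecAt Lc (toSite rr) cE cVH 0 k)) C δ :=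
  exists_hBv_of_rootedRows_poly hLc hcE cVH p (rowV_three_at hLc cVH) (shapeVt_three_at (le_trans (by norm_num) hLc) cVH)
    (shapeV0_at (le_trans (by norm_num) hLc) cVH) hCgV

/-- NOT IN PRINT; OUR PROOF ATTEMPT — CONDITIONAL ON ONE LETTER ([folklore] assembly).  **hB OF THE `d = 3` COMB FAMILY FROM THE V CONTACT LETTER ALONE** (leaf-01's
`BornLambdaLineage.exists_hB_of_sectors`: hB ⇐ hB(cVH,0) ∧ hB(0,cΛ), the Λ half hypothesis-free by leaf-04 g56's `BornLambdaSectorRowHolds.exists_hBLam_three`). -/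
theorem exists_hB_three_of_contact (hLc : 2 ≤ Lc) {cE : ℝ} (hcE : cE = (Lc : ℝ) ^ (3 + 1)) (cVH cΛ : ℝ) (p : ℕ)
    (hCgV : ∃ C θ δ : ℝ, 0 ≤ C ∧ 0 ≤ θ ∧ θ < 1 ∧ 0 < δ ∧ ∀ (rr : Fin (3 + 1) → ℕ), rr ∈ box (3 + 1) Lc → ∀ k i : ℕ, i < k →
      LocStencil (transport (unitStepMap Lc (toSite rr) cE) (i + 1) (k - 1 - i)
          (unitStepMap Lc (toSite rr) cE i (fun κ u => cVH • vhSAt (toSite rr) 3 Lc rfl κ u))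
        - fun κ' u' => (cE * (Lc : ℝ) ^ (2 * (3 + 1))) ^ (k - i) •
          push₃ (respStep (d := 3) (Lc ^ (i + 1)) (Lc ^ k)) (respStep (d := 3) (Lc ^ (i + 1)) (Lc ^ k)) (respStep (d := 3) (Lc ^ (i + 1)) (Lc ^ k))
            (fun κ u => -(push₃ (-respStep (d := 3) (Lc ^ i) (Lc ^ (i + 1))) (colM (KStepUnit (d := 3) Lc i) Lc)
                  (respStep (d := 3) (Lc ^ i) (Lc ^ (i + 1))) (reslot Sum.inl Sum.inr fun κ u => cVH • vhSAt (toSite rr) 3 Lc rfl κ u) κ u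
              + push₃ (rowMM (KStepUnit (d := 3) Lc i) Lc) (respStep (d := 3) (Lc ^ i) (Lc ^ (i + 1)))
                  (respStep (d := 3) (Lc ^ i) (Lc ^ (i + 1))) (reslot Sum.inr Sum.inl fun κ u => cVH • vhSAt (toSite rr) 3 Lc rfl κ u) κ u)) κ' u')
        (C * (((k - i : ℕ) : ℝ) ^ p * θ ^ (k - i))) δ) :
    ∃ C δ : ℝ, 0 < δ ∧ ∀ (rr : Fin (3 + 1) → ℕ), rr ∈ box (3 + 1) Lc →
      ∀ j : ℕ, LocStencil (unitS (sfStep Lc j) (smStep 3 Lc j) (bornSecAt Lc (toSite rr) cE cVH cΛ j)) C δ :=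
  exists_hB_of_sectors cE cVH cΛ (exists_hBv_three_of_contact_poly hLc hcE cVH p hCgV) (exists_hBLam_three hLc hcE cΛ)

/-- NOT IN PRINT; OUR PROOF ATTEMPT — CONDITIONAL ON ONE LETTER ([folklore] assembly).  **hS0 OF THE `d = 3` COMB FAMILY (E) = `WardLocusRecursive.SrecAt` FROM THE V CONTACT LETTER
ALONE** (the Wilson row `WilsonSectorRowHolds.exists_hS0_wilsonSec` + hB above, through `SrecAtRowOfSectors.exists_hS0_SrecAt_of_sectors`).  hS0 is the FIRST of the two CT-4 hypotheses of
`SrecAtStability`; (hSall) ∕ CT-5 are separate; NOT (CONV-C). -/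
theorem exists_hS0_SrecAt_three_of_contact (hLc : 2 ≤ Lc) {cE : ℝ} (hcE : cE = (Lc : ℝ) ^ (3 + 1)) (cVH cΛ : ℝ) (p : ℕ)
    (hCgV : ∃ C θ δ : ℝ, 0 ≤ C ∧ 0 ≤ θ ∧ θ < 1 ∧ 0 < δ ∧ ∀ (rr : Fin (3 + 1) → ℕ), rr ∈ box (3 + 1) Lc → ∀ k i : ℕ, i < k →
      LocStencil (transport (unitStepMap Lc (toSite rr) cE) (i + 1) (k - 1 - i)
          (unitStepMap Lc (toSite rr) cE i (fun κ u => cVH • vhSAt (toSite rr) 3 Lc rfl κ u))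
        - fun κ' u' => (cE * (Lc : ℝ) ^ (2 * (3 + 1))) ^ (k - i) •
          push₃ (respStep (d := 3) (Lc ^ (i + 1)) (Lc ^ k)) (respStep (d := 3) (Lc ^ (i + 1)) (Lc ^ k)) (respStep (d := 3) (Lc ^ (i + 1)) (Lc ^ k))
            (fun κ u => -(push₃ (-respStep (d := 3) (Lc ^ i) (Lc ^ (i + 1))) (colM (KStepUnit (d := 3) Lc i) Lc)
                  (respStep (d := 3) (Lc ^ i) (Lc ^ (i + 1))) (reslot Sum.inl Sum.inr fun κ u => cVH • vhSAt (toSite rr) 3 Lc rfl κ u) κ u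
              + push₃ (rowMM (KStepUnit (d := 3) Lc i) Lc) (respStep (d := 3) (Lc ^ i) (Lc ^ (i + 1)))
                  (respStep (d := 3) (Lc ^ i) (Lc ^ (i + 1))) (reslot Sum.inr Sum.inl fun κ u => cVH • vhSAt (toSite rr) 3 Lc rfl κ u) κ u)) κ' u')
        (C * (((k - i : ℕ) : ℝ) ^ p * θ ^ (k - i))) δ) :
    ∃ Cs δS : ℝ, 0 < δS ∧ ∀ (rr : Fin (3 + 1) → ℕ), rr ∈ box (3 + 1) Lc →
      ∀ j : ℕ, LocStencil (unitS (sfStep Lc j) (smStep 3 Lc j) (SrecAt 3 Lc (toSite rr) cE cVH cΛ j)) Cs δS :=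
  exists_hS0_SrecAt_of_sectors cE cVH cΛ (exists_hS0_wilsonSec hLc hcE) (exists_hB_three_of_contact hLc hcE cVH cΛ p hCgV)

end Summit.QuantumFields.BalabanUV.Beta.GAN24.SrecAtBornRowHolds

end
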